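import Literature.AlgebraicGeometry.Motives.HodgeThetaDerivedTimesAbelian
import Literature.AlgebraicGeometry.Motives.HodgeThetaAnnihilatorTimesNonCMCurve
import HarnessLib

/-!
# Rational tensors on `V₁ ⊕ V₂` killed by `Θ` are killed by `Θ₁ ⊕ 0` when the skew centre of `End_Hdg(V₁)` is a line `ℚφ₁`, `V₂` is the `H¹` of a CM elliptic curve `ℚ(φ₂)`, and the `Θ`-trace slopes of `φ₁`, `φ₂` are rationally independent (Moonen–Zarhin 1999 Lemma (3.6) / Prop. (3.8): `Hg(X × E) = Hg(X) × Hg(E)` unless `End⁰(E) = k` embeds into the centre of `End⁰(X)` — the Lie step for a centre of rank one)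

Family `hodge`, layer `Literature/AlgebraicGeometry/Motives` (abstract polarizable `ℚ`-Hodge structures; no
geometry). Research context: cell `pub-hodge-ring2` (HONEST FRAMING: research route conditional on HC_CM; not a
corollary; Q11.4-sentence-2 already refuted in dim ≥ 3), Literature lane, programme R24 «`E_k × T`, `T` a simple
abelian threefold of type IV(1,1) NOT of CM type, `k ≇ End⁰(T)`», abstract half. UNCONDITIONAL linear algebra /
Hodge theory; theorems only (no definition, no named fact, D-0026; nothing admitted); no step towards a summit
statement. It is the sequel of `HodgeThetaDerivedTimesAbelian` (cell seat `motiv`), which treats the first factor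
under the `Θ`-TRACE CONDITION («`Hg(A)` semisimple»: `Θ₁` trace-orthogonal to the centre, so `Θ₁ ∈ 𝔡(𝔤₁)_ℂ`);
here the `Θ`-trace condition FAILS (a central torus of rank one: «residual (r1)» of that file) and the second
factor is the rank-one torus of a CM elliptic curve.

PRINTED RESULTS, Lie-algebra form. B. Moonen, Yu. Zarhin, *Hodge classes on abelian varieties of low dimension*,
Math. Ann. 315 (1999) 711–733 [held: `paper:arxiv-math_9901113`], §3:
* (3.1) (p. 6): `hg(X₁ × X₂) ≅ 𝔤₁ ⊕ 𝔤₂ ⊕ Γ_φ ⊆ hg(X₁) ⊕ hg(X₂)`, «`𝔤₃ ≠ 0` … if and only if for some `m` and `n` the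
  Hodge ring `B(X₁^m × X₂^n)` is not generated by the elements coming from `B(X₁^m)` and `B(X₂^n)`»;
* Lemma (3.6) (p. 7): «Assume that the Hodge group `Hg(X₂)` is a `ℚ`-simple algebraic torus. (In particular `X₂` is
  of CM-type.) Write `X = X₁ × X₂`. If `Hg(X) ≠ Hg(X₁) × Hg(X₂)` then the center of `Hg(X₁)` contains an algebraic
  torus which is `ℚ`-isogenous to `Hg(X₂)`»;
* Prop. (3.8) (p. 7): «Let `X` be an abelian variety and let `E` be an elliptic curve, both over `ℂ`. Suppose
  `Hom(E,X) = 0`. Then either `Hg(X × E) = Hg(X) × Hg(E)` or `End⁰(E) = k` is an imaginary quadratic field such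
  that there exists an embedding of `k` into the center of `End⁰(X)`»;
* Thm. 0.1 (4) with case (a) (p. 1): «`X₁` an elliptic curve with complex multiplication by an imaginary quadratic
  field `k` and `X₂` a simple abelian threefold such that there exists an embedding `k ↪ End⁰(X₂)`» is the ONLY
  exceptional shape `E × T`; otherwise `Hg(X) = Sp_D(V,φ)` and `B(Xⁿ) = D(Xⁿ)` for all `n`.
P. Deligne, LNM 900 (1982), I Prop. 3.6 (`Hg` reductive) — the tree's `ThetaSubalgebra.center_sup_derived_eq`.

THIS FILE (the Lie step of Lemma (3.6) / Prop. (3.8) for a centre of rank ONE, in the tree's word model). SETTING: a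
`ℚ`-space `U = ι₁V₁ ⊕ ι₂V₂`, effective weight-one Hodge structures `H_U, H₁, H₂` (`ι_i` map pieces into pieces),
polarizations `ψ₁, ψ₂`; on `V₁` a Hodge endomorphism `φ₁` such that EVERY `ψ₁`-SKEW CENTRAL HODGE ENDOMORPHISM OF
`V₁` IS A RATIONAL MULTIPLE OF `φ₁` (abelian varieties whose `End⁰` has centre an imaginary quadratic field
`k' = ℚ(φ₁)`: type IV with `e₀ = 1`; `φ₁ = 0` is the no-type-IV case); on `V₂`, `dim V₂ = 2` and a Hodge
endomorphism `φ₂` with `φ₂² = -d₂ < 0` (the `H¹` of an elliptic curve `E` with complex multiplication by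
`k = ℚ(√-d₂)`; `Lie Hg(E) = ℚφ₂ = 𝔲_k`, a rank-one torus). MAIN RESULT
(`wordDerAt_incl_theta_proj_eq_zero_of_rankOneCentre_times_cmCurve`): if the `Θ`-TRACE SLOPES are rationally
independent,

  (NONRES) `tr(φ₁²) · tr(Θ₂ ∘ φ₂,ℂ) ≠ c · tr(Θ₁ ∘ φ₁,ℂ) · tr(φ₂²)` for every RATIONAL `c`,

then every rational coefficient tensor `q` on `U` killed slice by slice by the matrix of `Θ_U` is killed by the
matrix of the partial Hodge operator `ι₁ ∘ Θ₁ ∘ π₁` («`Θ_X ⊕ 0 ∈ Lie Hg(X × E)_ℂ`», i.e. `Hg(X × E) = Hg(X) × Hg(E)`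
read on tensor invariants) — the conclusion of the tree's `wordDerAt_incl_theta_proj_eq_zero_of_thetaTrace_times_
abelian`, so the typed-Künneth pipeline of programme R5 applies verbatim to `X × E`. For `V₁ = H¹(T)`, `T` a simple
abelian threefold with `End⁰(T) = ℚ(√-d₁)` acting with multiplicities `(2,1)`, and `V₂ = H¹(E)`, `End⁰(E) = ℚ(√-d₂)`:
`tr(Θ₁φ₁) = ±2i√d₁`, `tr(φ₁²) = -6d₁`, `tr(Θ₂φ₂) = ±2i√d₂`, `tr(φ₂²) = -2d₂`, and (NONRES) says exactly
`d₁/d₂ ∉ (ℚ^×)²`, i.e. `k = ℚ(√-d₂) ≇ ℚ(√-d₁)` — «no embedding of `k` into the center of `End⁰(X)`» (Prop. (3.8));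
that translation (`§2`, `trace_theta_mul_baseChange_eq_of_sq_eq_neg`: `tr(Θ ∘ φ_ℂ) = μ·((n¹⁰_μ - n⁰¹_μ) - (n¹⁰_{-μ} -
n⁰¹_{-μ}))`) is proved here abstractly and consumed by the geometric companion
`HodgeTheory/RankOneCentreTimesCMCurveInvariance`.

PROOF (the R5 / `HodgeThetaDerivedTimesAbelian` proof verbatim up to the corner algebra, then NEW). Let
`𝔞 = annLie(q)` (killing `q`; commuting with `ι₁aπ₁` (`a ∈ End_Hdg V₁`), `ι₂φ₂π₂` and the two projectors; skew
for `ψ₁(π₁·,π₁·) + ψ₂(π₂·,π₂·)`), so `Θ_U ∈ 𝔞_ℂ`. The `V₂`-corners of `𝔞` are `ψ₂`-skew and commute with `φ₂`,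
hence (rank two, §1 `RankTwoCM.exists_eq_smul_of_commute_of_skew` + descent) lie in `ℚφ₂` and COMMUTE, so
(Goursat step, `bracket_eq_incl_corner_bracket_proj`) `[X,X'] = ι₁[c₁X, c₁X']π₁` and `ι₁ 𝔡(𝔤)_ℂ π₁ ⊆ 𝔞_ℂ` for the
corner algebra `𝔤 = c₁(𝔞) ∋_ℂ Θ₁`. By Deligne reductivity `𝔤 = 𝔷(𝔤) ⊕ 𝔡(𝔤)` and `𝔷(𝔤) ⊆` skew central Hodge
endomorphisms `⊆ ℚφ₁`, so `Θ₁ = wφ₁,ℂ + s`, `s ∈ 𝔡(𝔤)_ℂ`, and `tr(Θ₁φ₁) = w·tr(φ₁²)` (`tr(sφ₁) = 0`). If `w = 0` we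
are done. Otherwise `φ₁ ∈ 𝔤` (descent), i.e. some `X ∈ 𝔞` has corners `(φ₁, cφ₂)`, `c ∈ ℚ`; `Θ₂ = w₂φ₂,ℂ` with
`tr(Θ₂φ₂) = w₂ tr(φ₂²)`; and `Θ_U - ι₁sπ₁ - w·X_ℂ = (w₂ - wc)·ι₂φ₂,ℂπ₂ ∈ 𝔞_ℂ`. (NONRES) is `w₂ ≠ wc`, so
`ι₂φ₂π₂ ∈ 𝔞_ℂ`, `ι₂Θ₂π₂ ∈ 𝔞_ℂ` and `ι₁Θ₁π₁ = Θ_U - ι₂Θ₂π₂ ∈ 𝔞_ℂ`. (Moonen–Zarhin argue with algebraic tori: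
a non-split `Hg(X × E)` projects isogenously onto a rank-one central torus of `Hg(X)` `ℚ`-isogenous to `U_k`,
forcing `k ↪ F`; the rationality of `c` above is the Lie shadow of «`ℚ`-isogenous».)

CONTENTS. §1 rank two with complex multiplication (`RankTwoCM.*`: eigenvalues `±α` of `φ_ℂ` on a Hodge basis,
the skew commutant of `φ_ℂ` is `ℂφ_ℂ`, rational descent of a line); §2 the `Θ`-trace of an imaginary quadratic Hodge
endomorphism (`trace_restrict_theta_eq_finrank_sub`, `trace_theta_mul_baseChange_eq_of_sq_eq_neg`, and
`trace_mul_self_eq_of_sq_eq_neg`); §3 the product Lie step (`wordDerAt_incl_theta_proj_eq_zero_of_rankOneCentre_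
times_cmCurve`).

## References

* [MoonenZarhin1999LowDim] B. Moonen, Yu. Zarhin, Math. Ann. 315 (1999), §3 (3.1), Lemma (3.6), Prop. (3.8),
  Thm. 0.1 (4) with (a) (held `paper:arxiv-math_9901113` pp. 1, 6–7). [cite: MoonenZarhin1999LowDim, §3 Lemma (3.6) and Prop. (3.8)]
* [Deligne1982HodgeCycles] P. Deligne, LNM 900 (1982), I §3 Prop. 3.4, Prop. 3.6. [cite: Deligne1982HodgeCycles, I §3 Prop. 3.6]
* [Lombardo2016] D. Lombardo, Ann. Inst. Fourier 66 (2016), Lemma 3.4 (p. 1229) (the Goursat step). [cite: Lombardo2016, Lemma 3.4 (p. 1229)]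
* [Humphreys1972] J. E. Humphreys, GTM 9, §5.1, §19.1. [cite: Humphreys1972, §5.1]
-/

noncomputable section

open scoped TensorProduct
open CategoryTheory Module

namespace Literature.AlgebraicGeometry.Motives

namespace HodgeStructure

open Literature.RepresentationTheory.GeneralLinear

universe u

/-! ### §1 Rank two with complex multiplication: the `H¹` of a CM elliptic curve -/

section RankTwoCM

variable {V : Type u} [AddCommGroup V] [Module ℚ V] [Module.Finite ℚ V] {n : ℤ}

omit [Module.Finite ℚ V] in
/-- **Rational descent of a line**: a rational operator whose complexification is a complex multiple of `φ_ℂ` is a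
RATIONAL multiple of `φ` (`X ∈ ℚφ ↔ X_ℂ ∈ (ℚφ)_ℂ`, `mem_of_baseChange_mem_spanC`). The Lie shadow of «a torus
`ℚ`-isogenous to `U_k`» in Lemma (3.6). [cite: MoonenZarhin1999LowDim, §3 Lemma (3.6)]
[cite: Deligne1982HodgeCycles, I §3 (proof of Prop. 3.4)] -/
theorem exists_eq_ratCast_smul_of_baseChange_eq_smul [Module.Finite ℚ V] {R φ : Module.End ℚ V} {z : ℂ}
    (h : R.baseChange ℂ = z • φ.baseChange ℂ) : ∃ c : ℚ, R = c • φ := by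
  have hmem : R.baseChange ℂ ∈ spanC (ℚ ∙ φ) := by
    rw [h]
    exact Submodule.smul_mem _ z (baseChange_mem_spanC (Submodule.mem_span_singleton_self φ))
  obtain ⟨c, hc⟩ := Submodule.mem_span_singleton.1 (mem_of_baseChange_mem_spanC _ hmem)
  exact ⟨c, hc.symm⟩

omit [Module.Finite ℚ V] in
/-- A Hodge endomorphism maps `V^{p,q}` into itself (complexified). [cite: Deligne1982HodgeCycles, I §3 Prop. 3.4] -/
theorem baseChange_apply_mem_piece_of_mem_endAlg (H : HodgeStructure V n) {φ : Module.End ℚ V}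
    (hφE : φ ∈ H.endAlg) (p q : ℤ) {x : ℂ ⊗[ℚ] V} (hx : x ∈ H.piece p q) : φ.baseChange ℂ x ∈ H.piece p q :=
  (endAlg.toHom ⟨φ, hφE⟩).map_piece_le p q ⟨x, hx, rfl⟩

/-- **Eigenvalues `α, -α` of `φ_ℂ` on a Hodge basis of a rank-two weight-one structure with `φ² = -d < 0`**
(`φ ∈ End_Hdg(V)`, `dim V = 2`; `(v₊, v₋)` with `v₊ ∈ V^{1,0}`, `v₋ ∈ V^{0,1}`): `φ_ℂ v₊ = α v₊`, `φ_ℂ v₋ = -α v₋`,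
`α² = -d`. (`V^{1,0}`, `V^{0,1}` are `φ_ℂ`-stable lines; `α² = β² = -d`; `α = β` would make `tr φ = 2α` rational with
`α² < 0`.) The `H¹` of a CM elliptic curve: `k = ℚ(φ)` acts on `H^{1,0}`, `H^{0,1}` through its two embeddings.
[cite: MoonenZarhin1999LowDim, §2 (2.1)] [cite: Deligne1982HodgeCycles, §4 (p. 30)] -/
theorem RankTwoCM.exists_eigenvalues (H : HodgeStructure V n) (hn : n = 1) (heff : H.IsEffective)
    (hV : Module.finrank ℚ V = 2) {φ : Module.End ℚ V} (hφE : φ ∈ H.endAlg) {d : ℚ} (hd : 0 < d)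
    (hφ2 : φ * φ = -(d • 1)) {Θ : Module.End ℂ (ℂ ⊗[ℚ] V)}
    (hΘ : ∀ p, ∀ x ∈ H.piece p (n - p), Θ x = ((2 * p - n : ℤ) : ℂ) • x)
    (b : Module.Basis (Fin 2) ℂ (ℂ ⊗[ℚ] V)) (hb0 : b 0 ∈ H.piece 1 0) (hb1 : b 1 ∈ H.piece 0 1) :
    ∃ α : ℂ, α * α = -(d : ℂ) ∧ φ.baseChange ℂ (b 0) = α • b 0 ∧ φ.baseChange ℂ (b 1) = (-α) • b 1 := by
  obtain ⟨h10, h01⟩ := RankTwoTheta.finrank_pieces_eq_one H hn heff hV hΘ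
  -- the two lines are `φ_ℂ`-stable
  have hb0' : (⟨b 0, hb0⟩ : ↥(H.piece 1 0)) ≠ 0 := fun h => b.ne_zero 0 (congrArg Subtype.val h)
  have hb1' : (⟨b 1, hb1⟩ : ↥(H.piece 0 1)) ≠ 0 := fun h => b.ne_zero 1 (congrArg Subtype.val h)
  obtain ⟨α, hα⟩ := (finrank_eq_one_iff_of_nonzero' _ hb0').1 h10
    ⟨φ.baseChange ℂ (b 0), baseChange_apply_mem_piece_of_mem_endAlg H hφE 1 0 hb0⟩
  obtain ⟨β, hβ⟩ := (finrank_eq_one_iff_of_nonzero' _ hb1').1 h01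
    ⟨φ.baseChange ℂ (b 1), baseChange_apply_mem_piece_of_mem_endAlg H hφE 0 1 hb1⟩
  have hα' : φ.baseChange ℂ (b 0) = α • b 0 := by
    have h := congrArg Subtype.val hα
    simpa using h.symm
  have hβ' : φ.baseChange ℂ (b 1) = β • b 1 := by
    have h := congrArg Subtype.val hβ
    simpa using h.symm
  -- `α² = β² = -d`
  have hsq : ∀ {γ : ℂ} {x : ℂ ⊗[ℚ] V}, x ≠ 0 → φ.baseChange ℂ x = γ • x → γ * γ = -(d : ℂ) := by
    intro γ x hx hγ
    have h := UnitaryTheta.baseChange_baseChange_apply hφ2 x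
    rw [hγ, map_smul, hγ, smul_smul, ← neg_smul] at h
    exact smul_left_injective ℂ hx h
  have hαα : α * α = -(d : ℂ) := hsq (b.ne_zero 0) hα'
  have hββ : β * β = -(d : ℂ) := hsq (b.ne_zero 1) hβ'
  -- `tr φ_ℂ = α + β` is rational
  have htr : LinearMap.trace ℂ _ (φ.baseChange ℂ) = α + β := by
    rw [LinearMap.trace_eq_matrix_trace ℂ b, Matrix.trace, Fin.sum_univ_two, Matrix.diag_apply, Matrix.diag_apply,
      LinearMap.toMatrix_apply, LinearMap.toMatrix_apply, hα', hβ', map_smul, map_smul, b.repr_self, b.repr_self]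
    simp
  have htrQ : LinearMap.trace ℂ _ (φ.baseChange ℂ) = ((LinearMap.trace ℚ V φ : ℚ) : ℂ) := by
    rw [LinearMap.trace_baseChange]; rfl
  refine ⟨α, hαα, hα', ?_⟩
  -- `α = β` is impossible, hence `β = -α`
  have hαβ : (α - β) * (α + β) = 0 := by linear_combination hαα - hββ
  rcases mul_eq_zero.1 hαβ with h | h
  · exfalso
    have hαeq : α = β := sub_eq_zero.1 h
    set t : ℚ := LinearMap.trace ℚ V φ with ht
    have h2 : (2 : ℂ) * α = (t : ℂ) := by rw [two_mul]; nth_rewrite 2 [hαeq]; rw [← htr, htrQ]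
    have hα_eq : α = ((t / 2 : ℚ) : ℂ) := by
      rw [Rat.cast_div, Rat.cast_ofNat, ← h2]; ring
    have hreal : ((t / 2) * (t / 2) : ℚ) = -d := by
      have h3 := hαα
      rw [hα_eq, ← Rat.cast_mul, ← Rat.cast_neg] at h3
      exact_mod_cast h3
    nlinarith [mul_self_nonneg (t / 2)]
  · have hβeq : β = -α := by linear_combination h
    rw [hβ', hβeq]

/-- **The `ψ_ℂ`-skew commutant of `φ_ℂ` is the line `ℂφ_ℂ`** (rank two, weight one, `φ ∈ End_Hdg(V)`, `φ² = -d < 0`):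
a complex operator commuting with `φ_ℂ = diag(α, -α)` is diagonal in the Hodge basis, and `ψ_ℂ`-skewness makes it
trace-free (`RankTwoTheta.trace_eq_zero_of_skew`), hence a multiple of `φ_ℂ`. «`Hg(E) = U_k` has rank `1`»: `𝔲_k(V,ψ)_ℂ
= ℂφ_ℂ`. [cite: MoonenZarhin1999LowDim, §2 (2.1) and §3 Prop. (3.8) (proof)] [cite: Humphreys1972, §7.2] -/
theorem RankTwoCM.exists_eq_smul_of_commute_of_skew [HodgeTensorFacts.{u, u}] (H : HodgeStructure V n) (hn : n = 1)
    (heff : H.IsEffective) (hV : Module.finrank ℚ V = 2) (ψ : H.Polarization) {φ : Module.End ℚ V}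
    (hφE : φ ∈ H.endAlg) {d : ℚ} (hd : 0 < d) (hφ2 : φ * φ = -(d • 1)) {Y : Module.End ℂ (ℂ ⊗[ℚ] V)}
    (hYφ : Y * φ.baseChange ℂ = φ.baseChange ℂ * Y)
    (hY : ∀ x y, ψ.form.baseChange ℂ (Y x) y + ψ.form.baseChange ℂ x (Y y) = 0) :
    ∃ z : ℂ, Y = z • φ.baseChange ℂ := by
  classical
  obtain ⟨Θ, hΘ⟩ := exists_hodgeTheta H
  obtain ⟨b, hb0, hb1⟩ := RankTwoTheta.exists_basis H hn heff hV hΘ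
  obtain ⟨α, hαα, hα0, hα1⟩ := RankTwoCM.exists_eigenvalues H hn heff hV hφE hd hφ2 hΘ b hb0 hb1
  have hαne : α ≠ 0 := by
    rintro rfl
    rw [mul_zero, eq_comm, neg_eq_zero] at hαα
    exact hd.ne' (by exact_mod_cast hαα)
  set M := LinearMap.toMatrix b b Y with hM
  -- off-diagonal entries vanish: `φ_ℂ (Y v₊) = α Y v₊`, `φ_ℂ (Y v₋) = -α Y v₋`
  have hY0 : Y (b 0) = M 0 0 • b 0 + M 1 0 • b 1 := RankTwoTheta.apply_basis_eq b Y 0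
  have hY1 : Y (b 1) = M 0 1 • b 0 + M 1 1 • b 1 := RankTwoTheta.apply_basis_eq b Y 1
  have hc0 : φ.baseChange ℂ (Y (b 0)) = α • Y (b 0) := by
    rw [← Module.End.mul_apply, ← hYφ, Module.End.mul_apply, hα0, map_smul]
  have hc1 : φ.baseChange ℂ (Y (b 1)) = (-α) • Y (b 1) := by
    rw [← Module.End.mul_apply, ← hYφ, Module.End.mul_apply, hα1, map_smul]
  have hM10 : M 1 0 = 0 := by
    rw [hY0, map_add, map_smul, map_smul, hα0, hα1, smul_add, smul_smul, smul_smul, smul_smul, smul_smul] at hc0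
    have h := congrArg (fun v => b.repr v 1) hc0
    simp only [map_add, map_smul, b.repr_self] at h
    norm_num at h
    have h' : (2 * α) * M 1 0 = 0 := by linear_combination -h
    exact (mul_eq_zero.1 h').resolve_left (mul_ne_zero two_ne_zero hαne)
  have hM01 : M 0 1 = 0 := by
    rw [hY1, map_add, map_smul, map_smul, hα0, hα1, smul_add, smul_smul, smul_smul, smul_smul, smul_smul] at hc1
    have h := congrArg (fun v => b.repr v 0) hc1
    simp only [map_add, map_smul, b.repr_self] at h
    norm_num at h
    have h' : (2 * α) * M 0 1 = 0 := by linear_combination h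
    exact (mul_eq_zero.1 h').resolve_left (mul_ne_zero two_ne_zero hαne)
  have htr : M 0 0 + M 1 1 = 0 := RankTwoTheta.trace_eq_zero_of_skew H hn ψ b hY
  refine ⟨M 0 0 * α⁻¹, b.ext fun i => ?_⟩
  fin_cases i
  · change Y (b 0) = (M 0 0 * α⁻¹) • φ.baseChange ℂ (b 0)
    rw [hY0, hM10, zero_smul, add_zero, hα0, smul_smul, mul_assoc, inv_mul_cancel₀ hαne, mul_one]
  · change Y (b 1) = (M 0 0 * α⁻¹) • φ.baseChange ℂ (b 1)
    have h11 : M 1 1 = -M 0 0 := by linear_combination htr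
    rw [hY1, hM01, zero_smul, zero_add, hα1, smul_smul, h11, mul_assoc, mul_neg, inv_mul_cancel₀ hαne, mul_neg_one]

/-- **Rational form**: a RATIONAL `ψ`-skew operator commuting with `φ` is a rational multiple of `φ` (rank two as
above) — «`Lie Hg(E) ⊆ 𝔲_k = ℚφ`». [cite: MoonenZarhin1999LowDim, §2 (2.1)] [cite: Deligne1982HodgeCycles, I §3 (proof of Prop. 3.4)] -/
theorem RankTwoCM.exists_eq_ratCast_smul_of_commute_of_skew [HodgeTensorFacts.{u, u}] (H : HodgeStructure V n)
    (hn : n = 1) (heff : H.IsEffective) (hV : Module.finrank ℚ V = 2) (ψ : H.Polarization) {φ : Module.End ℚ V}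
    (hφE : φ ∈ H.endAlg) {d : ℚ} (hd : 0 < d) (hφ2 : φ * φ = -(d • 1)) {R : Module.End ℚ V}
    (hRφ : R * φ = φ * R) (hR : ∀ v w, ψ.form (R v) w + ψ.form v (R w) = 0) : ∃ c : ℚ, R = c • φ := by
  have hRφC : R.baseChange ℂ * φ.baseChange ℂ = φ.baseChange ℂ * R.baseChange ℂ := by
    rw [← LinearMap.baseChange_mul, hRφ, LinearMap.baseChange_mul]
  have hRC : ∀ x y, ψ.form.baseChange ℂ (R.baseChange ℂ x) y + ψ.form.baseChange ℂ x (R.baseChange ℂ y) = 0 :=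
    ThetaSubalgebra.formBaseChange_add_eq_zero_of_skew ψ hR
  obtain ⟨z, hz⟩ := RankTwoCM.exists_eq_smul_of_commute_of_skew H hn heff hV ψ hφE hd hφ2 hRφC hRC
  exact exists_eq_ratCast_smul_of_baseChange_eq_smul hz

end RankTwoCM

/-! ### §2 The `Θ`-trace of an imaginary quadratic Hodge endomorphism -/

section ThetaTrace

variable {V : Type u} [AddCommGroup V] [Module ℚ V] [Module.Finite ℚ V] {n : ℤ}

/-- **The `Θ`-trace of an imaginary quadratic Hodge endomorphism.** For `φ ∈ End_Hdg(V)` with `φ² = -d`, `d > 0`,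
and `μ² = -d`: `V_ℂ = ⊕_{γ = ±μ, (p,q)} (W_γ ∩ V^{p,q})` (`W_γ = ker(φ_ℂ - γ)`; `Θ` and `φ_ℂ` commute), and

  `tr(Θ ∘ φ_ℂ) = μ · (n¹⁰_μ - n⁰¹_μ) - μ · (n¹⁰_{-μ} - n⁰¹_{-μ})`, `n^{pq}_γ = dim_ℂ (W_γ ∩ V^{p,q})`.

For `V = H¹(A)` with `k = ℚ(φ) ⊆ End⁰(A)` acting on `H^{1,0}` with multiplicities `(n', n'')` this is
`2μ(n' - n'')` (`n⁰¹_γ = n¹⁰_{γ̄}`): it vanishes iff the multiplicities are balanced (Moonen–Zarhin's criterion for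
`Hg` semisimple, the `Θ`-trace condition of `HodgeThetaDerivedTimesAbelian`), and its ratio to `tr(φ²) = -d·dim V` is
the slope of the central component of `Θ`. (The four joint eigenspaces lie in distinct eigenspaces of
`φ_ℂ + 2μΘ`, whence their independence.) [cite: MoonenZarhin1998WeilClasses, §1 Remark (1) after Criterion (2)]
[cite: MoonenZarhin1999LowDim, §2 (2.3) and §5 (5.3)] [cite: Deligne1982HodgeCycles, §4 (p. 30)] -/
theorem trace_theta_mul_baseChange_eq_of_sq_eq_neg [HodgeTensorFacts.{u, u}] (H : HodgeStructure V n) (hn : n = 1)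
    (heff : H.IsEffective) {φ : Module.End ℚ V} (hφE : φ ∈ H.endAlg) {d : ℚ} (hd : 0 < d)
    (hφ2 : φ * φ = -(d • 1)) {μ : ℂ} (hμ : μ ^ 2 = -(d : ℂ)) {Θ : Module.End ℂ (ℂ ⊗[ℚ] V)}
    (hΘ : ∀ p, ∀ x ∈ H.piece p (n - p), Θ x = ((2 * p - n : ℤ) : ℂ) • x) :
    LinearMap.trace ℂ _ (Θ * φ.baseChange ℂ) =
      μ * ((Module.finrank ℂ ↥(Module.End.eigenspace (φ.baseChange ℂ) μ ⊓ H.piece 1 0) : ℂ) -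
          (Module.finrank ℂ ↥(Module.End.eigenspace (φ.baseChange ℂ) μ ⊓ H.piece 0 1) : ℂ)) -
      μ * ((Module.finrank ℂ ↥(Module.End.eigenspace (φ.baseChange ℂ) (-μ) ⊓ H.piece 1 0) : ℂ) -
          (Module.finrank ℂ ↥(Module.End.eigenspace (φ.baseChange ℂ) (-μ) ⊓ H.piece 0 1) : ℂ)) := by
  classical
  obtain ⟨hμ0, -⟩ := UnitaryTheta.conj_eq_neg_of_sq hd hμ
  obtain ⟨hP, hQ, hΘ10, hΘ01, -⟩ := UnitaryTheta.theta_facts H hn heff hΘ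
  have hΘC : Θ ∈ H.hodgeLieC := H.mem_hodgeLieC_of_forall_piece hΘ
  have hΘφ : Θ * φ.baseChange ℂ = φ.baseChange ℂ * Θ := commute_baseChange_of_mem_hodgeLieC H hΘC ⟨φ, hφE⟩
  -- the four joint eigenspaces, their `φ_ℂ`- and `Θ`-eigenvalues
  let γ : Bool → ℂ := fun c => cond c μ (-μ)
  let ε : Bool → ℂ := fun e => cond e 1 (-1)
  let Pc : Bool → Submodule ℂ (ℂ ⊗[ℚ] V) := fun e => cond e (H.piece 1 0) (H.piece 0 1)
  let N : Bool × Bool → Submodule ℂ (ℂ ⊗[ℚ] V) := fun ce =>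
    Module.End.eigenspace (φ.baseChange ℂ) (γ ce.1) ⊓ Pc ce.2
  have hΘPc : ∀ e, ∀ x ∈ Pc e, Θ x = ε e • x := by
    intro e x hx
    cases e with
    | true => simpa [ε] using hΘ10 x hx
    | false => simpa [ε] using hΘ01 x hx
  have hNφ : ∀ ce, ∀ x ∈ N ce, φ.baseChange ℂ x = γ ce.1 • x := fun ce x hx =>
    Module.End.mem_eigenspace_iff.1 (Submodule.mem_inf.1 hx).1
  have hNΘ : ∀ ce, ∀ x ∈ N ce, Θ x = ε ce.2 • x := fun ce x hx => hΘPc ce.2 x (Submodule.mem_inf.1 hx).2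
  -- independence: `N(c,e)` lies in the `(γ_c + 2μ ε_e)`-eigenspace of `L = φ_ℂ + 2μ Θ`, and these values are distinct
  set L : Module.End ℂ (ℂ ⊗[ℚ] V) := φ.baseChange ℂ + (2 * μ) • Θ with hL
  let r : Bool × Bool → ℤ := fun ce => cond ce.1 1 (-1) + 2 * cond ce.2 1 (-1)
  let v : Bool × Bool → ℂ := fun ce => (r ce : ℂ) * μ
  have hv : ∀ ce, γ ce.1 + 2 * μ * ε ce.2 = v ce := by
    rintro ⟨c, e⟩
    cases c <;> cases e <;> simp [v, r, γ, ε] <;> ring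
  have hrinj : Function.Injective r := by decide
  have hvinj : Function.Injective v := by
    intro ce ce' h
    have h' : (r ce : ℂ) = r ce' := mul_right_cancel₀ hμ0 h
    exact hrinj (by exact_mod_cast h')
  have hNle : ∀ ce, N ce ≤ Module.End.eigenspace L (v ce) := by
    intro ce x hx
    rw [Module.End.mem_eigenspace_iff, hL, LinearMap.add_apply, LinearMap.smul_apply, hNφ ce x hx, hNΘ ce x hx,
      smul_smul, ← add_smul, hv]
  have hind : iSupIndep N :=
    ((Module.End.eigenspaces_iSupIndep L).comp hvinj).mono fun ce => hNle ce
  -- exhaustion: `x = Σ` of the four joint components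
  have hPmem : ∀ {c : ℂ} {w : ℂ ⊗[ℚ] V}, w ∈ Module.End.eigenspace (φ.baseChange ℂ) c →
      (2 : ℂ)⁻¹ • (w + Θ w) ∈ Module.End.eigenspace (φ.baseChange ℂ) c ⊓ H.piece 1 0 ∧
      (2 : ℂ)⁻¹ • (w - Θ w) ∈ Module.End.eigenspace (φ.baseChange ℂ) c ⊓ H.piece 0 1 := by
    intro c w hw
    have hΘw : Θ w ∈ Module.End.eigenspace (φ.baseChange ℂ) c := UnitaryTheta.apply_mem_eigenspace_of_commute hΘφ hw
    exact ⟨Submodule.mem_inf.2 ⟨Submodule.smul_mem _ _ (Submodule.add_mem _ hw hΘw), hP w⟩,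
      Submodule.mem_inf.2 ⟨Submodule.smul_mem _ _ (Submodule.sub_mem _ hw hΘw), hQ w⟩⟩
  have hsup : iSup N = ⊤ := by
    rw [Submodule.eq_top_iff']
    intro x
    obtain ⟨w, hw, w', hw', rfl⟩ := UnitaryTheta.exists_eigen_add_eigen hφ2 hμ hμ0 x
    have hdec : ∀ y : ℂ ⊗[ℚ] V, y = (2 : ℂ)⁻¹ • (y + Θ y) + (2 : ℂ)⁻¹ • (y - Θ y) := fun y => by module
    rw [hdec w, hdec w']
    refine Submodule.add_mem _ (Submodule.add_mem _ ?_ ?_) (Submodule.add_mem _ ?_ ?_)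
    · exact Submodule.mem_iSup_of_mem (true, true) (hPmem hw).1
    · exact Submodule.mem_iSup_of_mem (true, false) (hPmem hw).2
    · exact Submodule.mem_iSup_of_mem (false, true) (hPmem hw').1
    · exact Submodule.mem_iSup_of_mem (false, false) (hPmem hw').2
  have hint : DirectSum.IsInternal N := DirectSum.isInternal_submodule_of_iSupIndep_of_iSup_eq_top hind hsup
  -- `Θ φ_ℂ = γ ε` on `N(c,e)`
  have hmaps : ∀ ce, Set.MapsTo (Θ * φ.baseChange ℂ) (N ce) (N ce) := by
    intro ce x hx
    simp only [SetLike.mem_coe] at hx ⊢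
    rw [Module.End.mul_apply, hNφ ce x hx, map_smul, hNΘ ce x hx, smul_smul]
    exact Submodule.smul_mem _ _ hx
  have hres : ∀ ce, (Θ * φ.baseChange ℂ).restrict (hmaps ce) = (γ ce.1 * ε ce.2) • LinearMap.id := by
    intro ce
    refine LinearMap.ext fun x => Subtype.ext ?_
    simp only [LinearMap.coe_restrict_apply, Module.End.mul_apply, LinearMap.smul_apply, LinearMap.id_coe, id_eq,
      Submodule.coe_smul]
    rw [hNφ ce _ x.2, map_smul, hNΘ ce _ x.2, smul_smul]
  have htr : ∀ ce, LinearMap.trace ℂ (N ce) ((Θ * φ.baseChange ℂ).restrict (hmaps ce)) =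
      γ ce.1 * ε ce.2 * (Module.finrank ℂ (N ce) : ℂ) := fun ce => by
    rw [hres ce, map_smul, LinearMap.trace_id, smul_eq_mul]
  have h1 : LinearMap.trace ℂ (N (true, true)) ((Θ * φ.baseChange ℂ).restrict (hmaps (true, true))) =
      μ * 1 * (Module.finrank ℂ ↥(Module.End.eigenspace (φ.baseChange ℂ) μ ⊓ H.piece 1 0) : ℂ) := htr (true, true)
  have h2 : LinearMap.trace ℂ (N (true, false)) ((Θ * φ.baseChange ℂ).restrict (hmaps (true, false))) =
      μ * (-1) * (Module.finrank ℂ ↥(Module.End.eigenspace (φ.baseChange ℂ) μ ⊓ H.piece 0 1) : ℂ) := htr (true, false)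
  have h3 : LinearMap.trace ℂ (N (false, true)) ((Θ * φ.baseChange ℂ).restrict (hmaps (false, true))) =
      (-μ) * 1 * (Module.finrank ℂ ↥(Module.End.eigenspace (φ.baseChange ℂ) (-μ) ⊓ H.piece 1 0) : ℂ) :=
    htr (false, true)
  have h4 : LinearMap.trace ℂ (N (false, false)) ((Θ * φ.baseChange ℂ).restrict (hmaps (false, false))) =
      (-μ) * (-1) * (Module.finrank ℂ ↥(Module.End.eigenspace (φ.baseChange ℂ) (-μ) ⊓ H.piece 0 1) : ℂ) :=
    htr (false, false)
  rw [LinearMap.trace_eq_sum_trace_restrict hint hmaps, Fintype.sum_prod_type, Fintype.sum_bool, Fintype.sum_bool,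
    Fintype.sum_bool, h1, h2, h3, h4]
  ring

omit [Module.Finite ℚ V] in
/-- `tr(φ²) = -d · dim V` for `φ² = -d`. [cite: MumfordAV1970, §21] [cite: MoonenZarhin1999LowDim, §2 (2.3)] -/
theorem trace_mul_self_eq_of_sq_eq_neg [Module.Finite ℚ V] {φ : Module.End ℚ V} {d : ℚ} (hφ2 : φ * φ = -(d • 1)) :
    LinearMap.trace ℚ V (φ * φ) = -(d * Module.finrank ℚ V) := by
  rw [hφ2, map_neg, map_smul, LinearMap.trace_one, smul_eq_mul]

end ThetaTrace

/-! ### §3 The product Lie step: a centre of rank one times a CM elliptic curve -/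

section Main

variable {U V₁ V₂ : Type u} [AddCommGroup U] [Module ℚ U] [AddCommGroup V₁] [Module ℚ V₁]
  [AddCommGroup V₂] [Module ℚ V₂] [Module.Finite ℚ U] [Module.Finite ℚ V₁] [Module.Finite ℚ V₂]
  [HodgeTensorFacts.{u, u}] {n : ℤ}
variable {M d m : ℕ}

omit [Module.Finite ℚ U] [Module.Finite ℚ V₁] [Module.Finite ℚ V₂] [HodgeTensorFacts.{u, u}] in
/-- Complexification of a sum of bilinear forms, evaluated (a copy of the private lemma of
`HodgeThetaAnnihilatorTimesNonCMCurve`). [folklore] -/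
private theorem baseChange_add_apply'' (B B' : LinearMap.BilinForm ℚ U) (x y : ℂ ⊗[ℚ] U) :
    LinearMap.BilinForm.baseChange ℂ (B + B') x y =
      LinearMap.BilinForm.baseChange ℂ B x y + LinearMap.BilinForm.baseChange ℂ B' x y := by
  induction x using TensorProduct.induction_on with
  | zero => simp
  | tmul c v =>
    induction y using TensorProduct.induction_on with
    | zero => simp
    | tmul d w =>
      simp only [LinearMap.BilinForm.baseChange_tmul, LinearMap.add_apply, add_smul]
    | add y y' hy hy' => rw [map_add, map_add, map_add, hy, hy']; abel
  | add x x' hx hx' =>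
    rw [map_add, LinearMap.add_apply, map_add, map_add, LinearMap.add_apply, LinearMap.add_apply, hx, hx']
    abel

omit [Module.Finite ℚ V₂] [HodgeTensorFacts.{u, u}] in
/-- Base change of a rational multiple: `(c • T)_ℂ = c • T_ℂ` (a copy of the lemma of `HodgeLieWeightOneRankFourCube`).
[cite: Deligne1982HodgeCycles, I §3 (proof of Prop. 3.4)] -/
private theorem baseChange_ratCast_smul' (c : ℚ) (T : Module.End ℚ V₂) :
    (c • T).baseChange ℂ = (c : ℂ) • T.baseChange ℂ := by
  refine TensorProduct.AlgebraTensorModule.ext fun z v => ?_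
  rw [LinearMap.baseChange_tmul, LinearMap.smul_apply, LinearMap.smul_apply, LinearMap.baseChange_tmul,
    TensorProduct.smul_tmul', ← TensorProduct.smul_tmul, Rat.smul_def, smul_eq_mul]

/-- **Theorem (Moonen–Zarhin 1999 Lemma (3.6) / Prop. (3.8) for a centre of rank one, Lie step, word model).** Let
`U = ι₁V₁ ⊕ ι₂V₂` be a presentation compatible with effective weight-one Hodge structures `H_U, H₁, H₂`,
polarizations `ψ₁, ψ₂`; `φ₁ ∈ End_Hdg(V₁)` such that every `ψ₁`-skew central Hodge endomorphism of `V₁` is a rational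
multiple of `φ₁` («the centre of `End⁰(X)` is an imaginary quadratic field `k' = ℚ(φ₁)`», or `φ₁ = 0`: no type IV);
`dim V₂ = 2` with `φ₂ ∈ End_Hdg(V₂)`, `φ₂² = -d₂ < 0` («`E` an elliptic curve with complex multiplication by
`k = ℚ(√-d₂)`»). Suppose the `Θ`-TRACE SLOPES ARE RATIONALLY INDEPENDENT:
`tr(φ₁²)·tr(Θ₂φ₂,ℂ) ≠ c·tr(Θ₁φ₁,ℂ)·tr(φ₂²)` for every rational `c` (for `X = T` a simple threefold of type IV(1,1) this is
`k ≇ k'`, §2). Then every RATIONAL coefficient tensor `q` on `U` killed slice by slice by the matrix of `Θ_U` is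
killed by the matrix of the partial Hodge operator `ι₁ ∘ Θ₁ ∘ π₁` — «`Hg(X × E) = Hg(X) × Hg(E)`» read on tensor
invariants; the conclusion of the tree's `wordDerAt_incl_theta_proj_eq_zero_of_thetaTrace_times_abelian`, so the
typed-Künneth pipeline of programme R5 applies verbatim. («If `Hg(X) ≠ Hg(X₁) × Hg(X₂)` then the center of `Hg(X₁)`
contains an algebraic torus which is `ℚ`-isogenous to `Hg(X₂)`»; «either `Hg(X × E) = Hg(X) × Hg(E)` or `End⁰(E) = k`
… embeds into the center of `End⁰(X)`».) [cite: MoonenZarhin1999LowDim, §3 Lemma (3.6) and Prop. (3.8)]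
[cite: MoonenZarhin1999LowDim, §3 (3.1)] [cite: Deligne1982HodgeCycles, I §3 Prop. 3.4 and Prop. 3.6]
[cite: Lombardo2016, Lemma 3.4 (p. 1229)] -/
theorem wordDerAt_incl_theta_proj_eq_zero_of_rankOneCentre_times_cmCurve (hn : n = 1) (HU : HodgeStructure U n)
    (H₁ : HodgeStructure V₁ n) (H₂ : HodgeStructure V₂ n) (heff₁ : H₁.IsEffective) (heff₂ : H₂.IsEffective)
    {ι₁ : V₁ →ₗ[ℚ] U} {π₁ : U →ₗ[ℚ] V₁} {ι₂ : V₂ →ₗ[ℚ] U} {π₂ : U →ₗ[ℚ] V₂}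
    (hπι₁ : π₁ ∘ₗ ι₁ = LinearMap.id) (hπι₂ : π₂ ∘ₗ ι₂ = LinearMap.id) (hπ₁ι₂ : π₁ ∘ₗ ι₂ = 0)
    (hπ₂ι₁ : π₂ ∘ₗ ι₁ = 0) (hsum : ι₁ ∘ₗ π₁ + ι₂ ∘ₗ π₂ = LinearMap.id)
    (hι₁F : ∀ p, ∀ x ∈ H₁.piece p (n - p), ι₁.baseChange ℂ x ∈ HU.piece p (n - p))
    (hι₂F : ∀ p, ∀ x ∈ H₂.piece p (n - p), ι₂.baseChange ℂ x ∈ HU.piece p (n - p))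
    (ψ₁ : H₁.Polarization) (ψ₂ : H₂.Polarization)
    {φ₁ : Module.End ℚ V₁} (hφ₁E : φ₁ ∈ H₁.endAlg)
    (hZ₁ : ∀ a ∈ H₁.endAlg, (∀ b ∈ H₁.endAlg, a * b = b * a) →
      (∀ v w, ψ₁.form (a v) w + ψ₁.form v (a w) = 0) → ∃ x : ℚ, a = x • φ₁)
    {φ₂ : Module.End ℚ V₂} (hφ₂E : φ₂ ∈ H₂.endAlg) {d₂ : ℚ} (hd₂ : 0 < d₂) (hφ₂ : φ₂ * φ₂ = -(d₂ • 1))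
    (hV₂ : Module.finrank ℚ V₂ = 2)
    (eQ : Module.Basis (Fin M) ℚ U) (q : (Fin d → Fin m × Fin M) → ℚ)
    {ΘU : Module.End ℂ (ℂ ⊗[ℚ] U)} (hΘU : ∀ p, ∀ x ∈ HU.piece p (n - p), ΘU x = ((2 * p - n : ℤ) : ℂ) • x)
    {Θ₁ : Module.End ℂ (ℂ ⊗[ℚ] V₁)} (hΘ₁ : ∀ p, ∀ x ∈ H₁.piece p (n - p), Θ₁ x = ((2 * p - n : ℤ) : ℂ) • x)
    {Θ₂ : Module.End ℂ (ℂ ⊗[ℚ] V₂)} (hΘ₂ : ∀ p, ∀ x ∈ H₂.piece p (n - p), Θ₂ x = ((2 * p - n : ℤ) : ℂ) • x)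
    (hres : ∀ c : ℚ, ((LinearMap.trace ℚ V₁ (φ₁ * φ₁) : ℚ) : ℂ) * LinearMap.trace ℂ _ (Θ₂ * φ₂.baseChange ℂ) ≠
      (c : ℂ) * (LinearMap.trace ℂ _ (Θ₁ * φ₁.baseChange ℂ) * ((LinearMap.trace ℚ V₂ (φ₂ * φ₂) : ℚ) : ℂ)))
    (hΘq : ∀ u : Fin d → Fin m, wordDerAt ℂ (fun _ : Fin d =>
      LinearMap.toMatrix (Algebra.TensorProduct.basis ℂ eQ) (Algebra.TensorProduct.basis ℂ eQ) ΘU)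
      (wordSlice (fun w => algebraMap ℚ ℂ (q w)) u) = 0)
    (u : Fin d → Fin m) :
    wordDerAt ℂ (fun _ : Fin d =>
      LinearMap.toMatrix (Algebra.TensorProduct.basis ℂ eQ) (Algebra.TensorProduct.basis ℂ eQ)
        (ι₁.baseChange ℂ ∘ₗ Θ₁ ∘ₗ π₁.baseChange ℂ))
      (wordSlice (fun w => algebraMap ℚ ℂ (q w)) u) = 0 := by
  classical
  have hΘ₁C : Θ₁ ∈ H₁.hodgeLieC := H₁.mem_hodgeLieC_of_forall_piece hΘ₁
  have hΘ₂C : Θ₂ ∈ H₂.hodgeLieC := H₂.mem_hodgeLieC_of_forall_piece hΘ₂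
  have hsum' : ι₂ ∘ₗ π₂ + ι₁ ∘ₗ π₁ = LinearMap.id := by rw [add_comm]; exact hsum
  -- pointwise slot identities
  have e11 : ∀ v, π₁ (ι₁ v) = v := fun v => by
    rw [← LinearMap.comp_apply (f := π₁), hπι₁, LinearMap.id_apply]
  have e22 : ∀ w, π₂ (ι₂ w) = w := fun w => by
    rw [← LinearMap.comp_apply (f := π₂), hπι₂, LinearMap.id_apply]
  have e12 : ∀ w, π₁ (ι₂ w) = 0 := fun w => by
    rw [← LinearMap.comp_apply (f := π₁), hπ₁ι₂, LinearMap.zero_apply]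
  have e21 : ∀ v, π₂ (ι₁ v) = 0 := fun v => by
    rw [← LinearMap.comp_apply (f := π₂), hπ₂ι₁, LinearMap.zero_apply]
  -- `Θ` through the presentation
  have hΘι₁ := theta_incl_eq HU H₁ hι₁F hΘU hΘ₁
  have hΘι₂ := theta_incl_eq HU H₂ hι₂F hΘU hΘ₂
  have hΘπ₁ := proj_theta_eq HU H₁ H₂ hπι₁ hπ₁ι₂ hsum hι₁F hι₂F hΘU hΘ₁ hΘ₂
  have hΘπ₂ := proj_theta_eq HU H₂ H₁ hπι₂ hπ₂ι₁ hsum' hι₂F hι₁F hΘU hΘ₂ hΘ₁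
  have hΘUdec : ΘU = ι₁.baseChange ℂ ∘ₗ Θ₁ ∘ₗ π₁.baseChange ℂ + ι₂.baseChange ℂ ∘ₗ Θ₂ ∘ₗ π₂.baseChange ℂ := by
    apply LinearMap.ext
    intro y
    conv_lhs => rw [← incl_proj_add_baseChange hsum y]
    rw [map_add, hΘι₁, hΘι₂]
    rfl
  -- the commuting family: `ι₁ a π₁` (`a ∈ End_Hdg V₁`), `ι₂ φ₂ π₂`, the two projectors; the orthogonal-sum form
  set aF : (H₁.endAlg ⊕ Unit) ⊕ (Unit ⊕ Unit) → Module.End ℚ U :=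
    Sum.elim (Sum.elim (fun a => ι₁ ∘ₗ (a : Module.End ℚ V₁) ∘ₗ π₁) (fun _ => ι₂ ∘ₗ φ₂ ∘ₗ π₂))
      (Sum.elim (fun _ => ι₁ ∘ₗ π₁) (fun _ => ι₂ ∘ₗ π₂)) with haF
  set φ : LinearMap.BilinForm ℚ U := ψ₁.form.compl₁₂ π₁ π₁ + ψ₂.form.compl₁₂ π₂ π₂ with hφ
  have hφC : ∀ x y, φ.baseChange ℂ x y = ψ₁.form.baseChange ℂ (π₁.baseChange ℂ x) (π₁.baseChange ℂ y) +
      ψ₂.form.baseChange ℂ (π₂.baseChange ℂ x) (π₂.baseChange ℂ y) := fun x y => by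
    rw [hφ, baseChange_add_apply'', baseChange_compl₁₂_apply, baseChange_compl₁₂_apply]
  have hφapply : ∀ x y, φ x y = ψ₁.form (π₁ x) (π₁ y) + ψ₂.form (π₂ x) (π₂ y) := fun x y => by
    rw [hφ, LinearMap.add_apply, LinearMap.add_apply, LinearMap.compl₁₂_apply, LinearMap.compl₁₂_apply]
  set 𝔞 : Submodule ℚ (Module.End ℚ U) := annLie φ eQ aF q with h𝔞
  -- `Θ_U ∈ 𝔞_ℂ`
  have hΘ𝔞 : ΘU ∈ spanC 𝔞 := by
    refine mem_spanC_annLie φ eQ aF q hΘq (fun i => ?_) (fun x y => ?_)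
    · apply LinearMap.ext
      intro y
      rcases i with (a | _) | (_ | _)
      · change ΘU ((ι₁ ∘ₗ (a : Module.End ℚ V₁) ∘ₗ π₁).baseChange ℂ y) =
          (ι₁ ∘ₗ (a : Module.End ℚ V₁) ∘ₗ π₁).baseChange ℂ (ΘU y)
        simp only [LinearMap.baseChange_comp, LinearMap.comp_apply]
        rw [hΘι₁, ← Module.End.mul_apply (f := Θ₁), commute_baseChange_of_mem_hodgeLieC H₁ hΘ₁C a,
          Module.End.mul_apply, hΘπ₁]
      · change ΘU ((ι₂ ∘ₗ φ₂ ∘ₗ π₂).baseChange ℂ y) = (ι₂ ∘ₗ φ₂ ∘ₗ π₂).baseChange ℂ (ΘU y)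
        simp only [LinearMap.baseChange_comp, LinearMap.comp_apply]
        rw [hΘι₂, ← Module.End.mul_apply (f := Θ₂), commute_baseChange_of_mem_hodgeLieC H₂ hΘ₂C ⟨φ₂, hφ₂E⟩,
          Module.End.mul_apply, hΘπ₂]
      · change ΘU ((ι₁ ∘ₗ π₁).baseChange ℂ y) = (ι₁ ∘ₗ π₁).baseChange ℂ (ΘU y)
        simp only [LinearMap.baseChange_comp, LinearMap.comp_apply]
        rw [hΘι₁, hΘπ₁]
      · change ΘU ((ι₂ ∘ₗ π₂).baseChange ℂ y) = (ι₂ ∘ₗ π₂).baseChange ℂ (ΘU y)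
        simp only [LinearMap.baseChange_comp, LinearMap.comp_apply]
        rw [hΘι₂, hΘπ₂]
    · rw [hφC, hφC, hΘπ₁, hΘπ₁, hΘπ₂, hΘπ₂, formBaseChange_skew_of_mem_hodgeLieC ψ₁ hΘ₁C,
        formBaseChange_skew_of_mem_hodgeLieC ψ₂ hΘ₂C]
      ring
  -- what membership in `𝔞` gives
  have hmem : ∀ X ∈ 𝔞, (∀ i, X * aF i = aF i * X) ∧ ∀ v w, φ (X v) w + φ v (X w) = 0 :=
    fun X hX => ((mem_annLie_iff φ eQ aF q X).1 hX).2
  have hP₁ : ∀ X ∈ 𝔞, X * (ι₁ ∘ₗ π₁) = (ι₁ ∘ₗ π₁) * X := fun X hX => (hmem X hX).1 (Sum.inr (Sum.inl ()))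
  have hP₂ : ∀ X ∈ 𝔞, X * (ι₂ ∘ₗ π₂) = (ι₂ ∘ₗ π₂) * X := fun X hX => (hmem X hX).1 (Sum.inr (Sum.inr ()))
  have hTa : ∀ X ∈ 𝔞, ∀ a : H₁.endAlg, X * (ι₁ ∘ₗ (a : Module.End ℚ V₁) ∘ₗ π₁) =
      (ι₁ ∘ₗ (a : Module.End ℚ V₁) ∘ₗ π₁) * X := fun X hX a => (hmem X hX).1 (Sum.inl (Sum.inl a))
  have hTφ₂ : ∀ X ∈ 𝔞, X * (ι₂ ∘ₗ φ₂ ∘ₗ π₂) = (ι₂ ∘ₗ φ₂ ∘ₗ π₂) * X :=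
    fun X hX => (hmem X hX).1 (Sum.inl (Sum.inr ()))
  -- the corners commute with `End_Hdg(V₁)` resp. `φ₂`, and are skew
  have hc₁comm : ∀ X ∈ 𝔞, ∀ a : H₁.endAlg, (π₁ ∘ₗ X ∘ₗ ι₁) * (a : Module.End ℚ V₁) =
      (a : Module.End ℚ V₁) * (π₁ ∘ₗ X ∘ₗ ι₁) := by
    intro X hX a
    apply LinearMap.ext
    intro v
    have h := congrArg (fun f : Module.End ℚ U => π₁ (f (ι₁ v))) (hTa X hX a)
    simp only [Module.End.mul_apply, LinearMap.comp_apply, e11] at h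
    simp only [Module.End.mul_apply, LinearMap.comp_apply]
    exact h
  have hc₂comm : ∀ X ∈ 𝔞, (π₂ ∘ₗ X ∘ₗ ι₂) * φ₂ = φ₂ * (π₂ ∘ₗ X ∘ₗ ι₂) := by
    intro X hX
    apply LinearMap.ext
    intro w
    have h := congrArg (fun g : Module.End ℚ U => π₂ (g (ι₂ w))) (hTφ₂ X hX)
    simp only [Module.End.mul_apply, LinearMap.comp_apply, e22] at h
    simp only [Module.End.mul_apply, LinearMap.comp_apply]
    exact h
  have hc₁skew : ∀ X ∈ 𝔞, ∀ v w, ψ₁.form ((π₁ ∘ₗ X ∘ₗ ι₁) v) w + ψ₁.form v ((π₁ ∘ₗ X ∘ₗ ι₁) w) = 0 := by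
    intro X hX v w
    have h := (hmem X hX).2 (ι₁ v) (ι₁ w)
    rw [apply_incl_eq_of_commute_projector hπι₁ (hP₁ X hX) v,
      apply_incl_eq_of_commute_projector hπι₁ (hP₁ X hX) w, hφapply, hφapply] at h
    simp only [e11, e21, map_zero, add_zero] at h
    simpa only [LinearMap.comp_apply] using h
  have hc₂skew : ∀ X ∈ 𝔞, ∀ v w, ψ₂.form ((π₂ ∘ₗ X ∘ₗ ι₂) v) w + ψ₂.form v ((π₂ ∘ₗ X ∘ₗ ι₂) w) = 0 := by
    intro X hX v w
    have h := (hmem X hX).2 (ι₂ v) (ι₂ w)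
    rw [apply_incl_eq_of_commute_projector hπι₂ (hP₂ X hX) v,
      apply_incl_eq_of_commute_projector hπι₂ (hP₂ X hX) w, hφapply, hφapply] at h
    simp only [e22, e12, map_zero, zero_add] at h
    simpa only [LinearMap.comp_apply] using h
  -- the `V₂`-corners lie on the line `ℚφ₂` (rank-one torus), hence commute
  have hc₂line : ∀ X ∈ 𝔞, ∃ c : ℚ, π₂ ∘ₗ X ∘ₗ ι₂ = c • φ₂ := fun X hX =>
    RankTwoCM.exists_eq_ratCast_smul_of_commute_of_skew H₂ hn heff₂ hV₂ ψ₂ hφ₂E hd₂ hφ₂ (hc₂comm X hX)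
      (hc₂skew X hX)
  have hc₂c : ∀ X ∈ 𝔞, ∀ X' ∈ 𝔞,
      (π₂ ∘ₗ X ∘ₗ ι₂) * (π₂ ∘ₗ X' ∘ₗ ι₂) = (π₂ ∘ₗ X' ∘ₗ ι₂) * (π₂ ∘ₗ X ∘ₗ ι₂) := by
    intro X hX X' hX'
    obtain ⟨c, hc⟩ := hc₂line X hX
    obtain ⟨c', hc'⟩ := hc₂line X' hX'
    rw [hc, hc', smul_mul_assoc, mul_smul_comm, smul_mul_assoc, mul_smul_comm, smul_comm]
  -- the Goursat step inside `𝔞`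
  have hbr𝔞 : ∀ X ∈ 𝔞, ∀ X' ∈ 𝔞,
      ι₁ ∘ₗ ((π₁ ∘ₗ X ∘ₗ ι₁) * (π₁ ∘ₗ X' ∘ₗ ι₁) - (π₁ ∘ₗ X' ∘ₗ ι₁) * (π₁ ∘ₗ X ∘ₗ ι₁)) ∘ₗ π₁ ∈ 𝔞 := by
    intro X hX X' hX'
    rw [← bracket_eq_incl_corner_bracket_proj hπι₁ hπι₂ hsum (hP₁ X hX) (hP₂ X hX) (hP₁ X' hX') (hP₂ X' hX')
      (hc₂c X hX X' hX')]
    exact commutator_mem_annLie φ eQ aF q hX hX'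
  -- the corner algebra `𝔤 = c₁(𝔞)`
  obtain ⟨cLin, hcLin⟩ : ∃ L : Module.End ℚ U →ₗ[ℚ] Module.End ℚ V₁, ∀ X, L X = π₁ ∘ₗ X ∘ₗ ι₁ :=
    ⟨{ toFun := fun X => π₁ ∘ₗ X ∘ₗ ι₁
       map_add' := fun X X' => by rw [LinearMap.add_comp, LinearMap.comp_add]
       map_smul' := fun c X => by rw [LinearMap.smul_comp, LinearMap.comp_smul, RingHom.id_apply] },
      fun X => rfl⟩
  set 𝔤 : Submodule ℚ (Module.End ℚ V₁) := 𝔞.map cLin with h𝔤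
  have h𝔤mem : ∀ {Y}, Y ∈ 𝔤 ↔ ∃ X ∈ 𝔞, π₁ ∘ₗ X ∘ₗ ι₁ = Y := by
    intro Y
    rw [h𝔤, Submodule.mem_map]
    simp only [hcLin]
  have hbr𝔤 : ∀ Y ∈ 𝔤, ∀ Y' ∈ 𝔤, Y * Y' - Y' * Y ∈ 𝔤 := by
    intro Y hY Y' hY'
    obtain ⟨X, hX, rfl⟩ := h𝔤mem.1 hY
    obtain ⟨X', hX', rfl⟩ := h𝔤mem.1 hY'
    refine h𝔤mem.2 ⟨_, hbr𝔞 X hX X' hX', ?_⟩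
    apply LinearMap.ext
    intro v
    simp only [LinearMap.comp_apply, LinearMap.sub_apply, Module.End.mul_apply, e11]
  have hcomm𝔤 : ∀ Y ∈ 𝔤, ∀ a : H₁.endAlg, Y * (a : Module.End ℚ V₁) = (a : Module.End ℚ V₁) * Y := by
    intro Y hY a
    obtain ⟨X, hX, rfl⟩ := h𝔤mem.1 hY
    exact hc₁comm X hX a
  have hskew𝔤 : ∀ Y ∈ 𝔤, ∀ v w, ψ₁.form (Y v) w + ψ₁.form v (Y w) = 0 := by
    intro Y hY v w
    obtain ⟨X, hX, rfl⟩ := h𝔤mem.1 hY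
    exact hc₁skew X hX v w
  have hspanC𝔤 : spanC 𝔤 = Submodule.span ℂ
      ((fun X : Module.End ℚ U => (π₁ ∘ₗ X ∘ₗ ι₁).baseChange ℂ) '' (𝔞 : Set _)) := by
    rw [spanC, h𝔤, Submodule.map_coe, Set.image_image]
    simp only [hcLin]
  -- `Θ₁ = c₁(Θ_U) ∈ 𝔤_ℂ`
  have hcorner : ∀ T ∈ spanC 𝔞, π₁.baseChange ℂ ∘ₗ T ∘ₗ ι₁.baseChange ℂ ∈ spanC 𝔤 := by
    intro T hT
    induction hT using Submodule.span_induction with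
    | mem Z hZ =>
      obtain ⟨X, hX, rfl⟩ := hZ
      rw [← LinearMap.baseChange_comp, ← LinearMap.baseChange_comp]
      exact baseChange_mem_spanC (h𝔤mem.2 ⟨X, hX, rfl⟩)
    | zero => rw [LinearMap.zero_comp, LinearMap.comp_zero]; exact Submodule.zero_mem _
    | add Z Z' _ _ hZ hZ' => rw [LinearMap.add_comp, LinearMap.comp_add]; exact Submodule.add_mem _ hZ hZ'
    | smul c Z _ hZ => rw [LinearMap.smul_comp, LinearMap.comp_smul]; exact Submodule.smul_mem _ c hZ
  have hΘ₁𝔤 : Θ₁ ∈ spanC 𝔤 := by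
    have h : Θ₁ = π₁.baseChange ℂ ∘ₗ ΘU ∘ₗ ι₁.baseChange ℂ := by
      apply LinearMap.ext
      intro x
      rw [LinearMap.comp_apply, LinearMap.comp_apply, hΘι₁, proj_incl_baseChange hπι₁]
    rw [h]
    exact hcorner ΘU hΘ𝔞
  -- brackets of elements of `𝔤_ℂ`, placed on `V₁`, lie in `𝔞_ℂ`
  have hD : ∀ Y ∈ spanC 𝔤, ∀ Y' ∈ spanC 𝔤,
      ι₁.baseChange ℂ ∘ₗ (Y * Y' - Y' * Y) ∘ₗ π₁.baseChange ℂ ∈ spanC 𝔞 := by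
    intro Y hY Y' hY'
    rw [hspanC𝔤] at hY hY'
    exact incl_bracket_proj_mem_spanC 𝔞 hbr𝔞 hY hY'
  -- NEW: Deligne reductivity `𝔤 = 𝔷(𝔤) ⊕ 𝔡(𝔤)`, `𝔷(𝔤) ⊆ ℚφ₁`, `Θ₁ = wφ₁,ℂ + s`
  set 𝔷 : Submodule ℚ (Module.End ℚ V₁) :=
    𝔤 ⊓ Subalgebra.toSubmodule (Subalgebra.centralizer ℚ (𝔤 : Set (Module.End ℚ V₁))) with h𝔷
  set 𝔡 : Submodule ℚ (Module.End ℚ V₁) := Submodule.span ℚ {B | ∃ X ∈ 𝔤, ∃ Y ∈ 𝔤, X * Y - Y * X = B} with h𝔡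
  have h𝔷mem : ∀ {Z}, Z ∈ 𝔷 ↔ Z ∈ 𝔤 ∧ ∀ Y ∈ 𝔤, Z * Y = Y * Z := fun {Z} =>
    Literature.Algebra.Lie.TraceSeparating.mem_center_iff 𝔤 Z
  have hdec : 𝔷 ⊔ 𝔡 = 𝔤 := ThetaSubalgebra.center_sup_derived_eq H₁ hn heff₁ ψ₁ 𝔤 hbr𝔤 hΘ₁ hΘ₁𝔤 hskew𝔤
  have h𝔷le : spanC 𝔷 ≤ ℂ ∙ φ₁.baseChange ℂ := by
    refine Submodule.span_le.2 ?_
    rintro _ ⟨Z, hZ, rfl⟩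
    obtain ⟨hZ𝔤, hZc⟩ := h𝔷mem.1 hZ
    obtain ⟨hZE, hZcE⟩ := mem_endAlg_and_commute_of_mem_center H₁ 𝔤 hΘ₁ hΘ₁𝔤 hcomm𝔤 hZ𝔤 hZc
    obtain ⟨x, rfl⟩ := hZ₁ Z hZE hZcE (hskew𝔤 Z hZ𝔤)
    change (x • φ₁).baseChange ℂ ∈ ℂ ∙ φ₁.baseChange ℂ
    rw [LinearMap.baseChange_smul]
    exact Submodule.smul_of_tower_mem _ x (Submodule.mem_span_singleton_self _)
  have hΘ' : Θ₁ ∈ spanC 𝔷 ⊔ spanC 𝔡 := by rw [← spanC_sup, hdec]; exact hΘ₁𝔤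
  obtain ⟨z, hz, s, hs, hzs⟩ := Submodule.mem_sup.1 hΘ'
  obtain ⟨w, hw⟩ := Submodule.mem_span_singleton.1 (h𝔷le hz)
  -- `ι₁ s π₁ ∈ 𝔞_ℂ` (Goursat)
  have hsmem : ι₁.baseChange ℂ ∘ₗ s ∘ₗ π₁.baseChange ℂ ∈ spanC 𝔞 :=
    incl_comp_proj_mem_spanC_of_mem_span_commutators 𝔞 hD (mem_span_commutators_baseChange_of_mem_spanC_derived hs)
  -- traces: `tr(Θ₁φ₁) = w·tr(φ₁²)`, `Θ₂ = w₂φ₂,ℂ`, `tr(Θ₂φ₂) = w₂·tr(φ₂²)`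
  have htr₁ : LinearMap.trace ℂ _ (Θ₁ * φ₁.baseChange ℂ) = w * ((LinearMap.trace ℚ V₁ (φ₁ * φ₁) : ℚ) : ℂ) := by
    have hφ₁c : ∀ Y ∈ 𝔤, φ₁ * Y = Y * φ₁ := fun Y hY => (hcomm𝔤 Y hY ⟨φ₁, hφ₁E⟩).symm
    rw [← hzs, add_mul, map_add, trace_spanC_derived_mul_baseChange_eq_zero 𝔤 hφ₁c hs, add_zero, ← hw,
      smul_mul_assoc, map_smul, ← LinearMap.baseChange_mul, LinearMap.trace_baseChange, smul_eq_mul]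
    rfl
  obtain ⟨w₂, hw₂⟩ := RankTwoCM.exists_eq_smul_of_commute_of_skew H₂ hn heff₂ hV₂ ψ₂ hφ₂E hd₂ hφ₂ (Y := Θ₂)
    (commute_baseChange_of_mem_hodgeLieC H₂ hΘ₂C ⟨φ₂, hφ₂E⟩)
    (fun x y => by rw [formBaseChange_skew_of_mem_hodgeLieC ψ₂ hΘ₂C, neg_add_cancel])
  have htr₂ : LinearMap.trace ℂ _ (Θ₂ * φ₂.baseChange ℂ) = w₂ * ((LinearMap.trace ℚ V₂ (φ₂ * φ₂) : ℚ) : ℂ) := by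
    rw [hw₂, smul_mul_assoc, map_smul, ← LinearMap.baseChange_mul, LinearMap.trace_baseChange, smul_eq_mul]
    rfl
  -- goal: `ι₁ Θ₁ π₁ ∈ 𝔞_ℂ`
  suffices hgoal : ι₁.baseChange ℂ ∘ₗ Θ₁ ∘ₗ π₁.baseChange ℂ ∈ spanC 𝔞 from
    wordDerAt_eq_zero_of_mem_spanC_annLie φ eQ aF q hgoal u
  by_cases hw0 : w = 0
  · -- the central component vanishes: `Θ₁ = s ∈ 𝔡(𝔤)_ℂ`
    have hΘ₁s : Θ₁ = s := by rw [← hzs, ← hw, hw0, zero_smul, zero_add]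
    rw [hΘ₁s]
    exact hsmem
  · -- `φ₁ ∈ 𝔤`: an `X ∈ 𝔞` with corners `(φ₁, cφ₂)`
    have hφ₁z : φ₁.baseChange ℂ ∈ spanC 𝔷 := by
      have h : φ₁.baseChange ℂ = w⁻¹ • z := by rw [← hw, smul_smul, inv_mul_cancel₀ hw0, one_smul]
      rw [h]
      exact Submodule.smul_mem _ _ hz
    have hφ₁𝔤 : φ₁ ∈ 𝔤 := (h𝔷mem.1 (mem_of_baseChange_mem_spanC 𝔷 hφ₁z)).1
    obtain ⟨X, hX, hXc⟩ := h𝔤mem.1 hφ₁𝔤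
    obtain ⟨c, hc⟩ := hc₂line X hX
    have hXC : X.baseChange ℂ = ι₁.baseChange ℂ ∘ₗ φ₁.baseChange ℂ ∘ₗ π₁.baseChange ℂ +
        (c : ℂ) • (ι₂.baseChange ℂ ∘ₗ φ₂.baseChange ℂ ∘ₗ π₂.baseChange ℂ) := by
      rw [baseChange_eq_incl_corner_add hπι₁ hπι₂ hsum (hP₁ X hX) (hP₂ X hX), hXc, hc, baseChange_ratCast_smul',
        LinearMap.smul_comp, LinearMap.comp_smul]
    have hXmem : X.baseChange ℂ ∈ spanC 𝔞 := baseChange_mem_spanC hX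
    -- `Θ_U - ι₁ s π₁ - w X_ℂ = (w₂ - w c) ι₂ φ₂,ℂ π₂ ∈ 𝔞_ℂ`
    have hT : ΘU - ι₁.baseChange ℂ ∘ₗ s ∘ₗ π₁.baseChange ℂ - w • X.baseChange ℂ =
        (w₂ - w * c) • (ι₂.baseChange ℂ ∘ₗ φ₂.baseChange ℂ ∘ₗ π₂.baseChange ℂ) := by
      rw [hΘUdec, hXC, ← hzs, ← hw, hw₂]
      simp only [LinearMap.comp_add, LinearMap.add_comp, LinearMap.comp_smul, LinearMap.smul_comp, smul_add,
        smul_smul]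
      module
    have hTmem : (w₂ - w * c) • (ι₂.baseChange ℂ ∘ₗ φ₂.baseChange ℂ ∘ₗ π₂.baseChange ℂ) ∈ spanC 𝔞 := by
      rw [← hT]
      exact Submodule.sub_mem _ (Submodule.sub_mem _ hΘ𝔞 hsmem) (Submodule.smul_mem _ _ hXmem)
    -- (NONRES): `w₂ ≠ w c`
    have hne : w₂ - w * c ≠ 0 := by
      intro h0
      have hw₂c : w₂ = w * c := sub_eq_zero.1 h0
      apply hres c
      rw [htr₁, htr₂, hw₂c]
      ring
    have hφ₂mem : ι₂.baseChange ℂ ∘ₗ φ₂.baseChange ℂ ∘ₗ π₂.baseChange ℂ ∈ spanC 𝔞 := by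
      have h := Submodule.smul_mem _ (w₂ - w * c)⁻¹ hTmem
      rwa [smul_smul, inv_mul_cancel₀ hne, one_smul] at h
    have hΘ₂mem : ι₂.baseChange ℂ ∘ₗ Θ₂ ∘ₗ π₂.baseChange ℂ ∈ spanC 𝔞 := by
      rw [hw₂, LinearMap.smul_comp, LinearMap.comp_smul]
      exact Submodule.smul_mem _ _ hφ₂mem
    have hΘ₁eq : ι₁.baseChange ℂ ∘ₗ Θ₁ ∘ₗ π₁.baseChange ℂ = ΘU - ι₂.baseChange ℂ ∘ₗ Θ₂ ∘ₗ π₂.baseChange ℂ := by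
      rw [hΘUdec, add_sub_cancel_right]
    rw [hΘ₁eq]
    exact Submodule.sub_mem _ hΘ𝔞 hΘ₂mem

end Main

end HodgeStructure

end Literature.AlgebraicGeometry.Motives

end
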